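import Summits.CriticalPhenomena.PercolationContinuityZ3.Theorems.PercNearOneGluingNoHeavyLowerTailTIncBernsteinStepHyp
import Summits.CriticalPhenomena.PercolationContinuityZ3.Theorems.PercNearOneGluingNoHeavyLowerTailBernsteinPieces
import Mathlib.Tactic.Linarith
import HarnessLib

/-!
# `NoHeavyLowerTail` (stmt-CriticalPhenomena-4575) — (TB1),(TB2) by fibrewise positivity, V: the MEASURE-LEVEL statements in the
# `bernsteinCells` vocabulary of `…BernsteinPieces` — the `T_inc` twins of `BernsteinPieceB1/B2`, for every finite weighted graph and all `a b c y`

Support file (prover prim-l12-p6 gen 3; `--supports stmt-CriticalPhenomena-4575`).  No definitions, no named facts, no sorries.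
For `μ = prodBernoulli w` on a finite vertex type and ANY vertices `a b c y` (no distinctness), with the ten masses
`m = (q, u₁ = μ(ab|c), u₂ = μ(ac|b), u₃ = μ(bc|a), t, α₁ = μ(a|by|c), α₂ = μ(a|b|cy), β₁ = μ(ab|cy), β₂ = μ(ac|by), β₃ = μ(a|bcy))` of
`bernsteinCells a b c y` (the pair `{a,y}` may itself carry any weight — it is then the random apex edge of `StepHypT`):
* `tincBernsteinPieces` : `0 ≤ threeTB₁ (m 0) … (m 9) ∧ 0 ≤ threeTB₂ (m 0) … (m 9)`;  `tincBernsteinPieceB1`, `tincBernsteinPieceB2`.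
Proof: `TIncFibre.stepHypT_holds` at `D = univ`, `K = ∅`, apex pair `s(a,y)` (`x = a`, `m = y`), then the dictionary finite sums ↔ `prodBernoulli`
(`prodBernoulli_real_eq_PrW_univ`) together with the identification of prove-2's transition events `evQ ∅ ∩ evU₁ {s(a,y)}`, … with the four-point cells
`a|by|c, a|b|cy, ab|cy, ac|by, a|bcy` (`reach_insert_cases`: a connection created by the edge `ay` passes through `y`); the case `a = y` separately
(all transition cells are empty and both pieces are `3·T_inc ≥ 0`, `TIncFibre.tincW_nonneg`).  These are the census objects of ttrl request l.640
(`TB1 = C̃(c1,c0,c0)`, `TB2 = C̃(c1,c1,c0)`; 0 violations in 230 M apex steps through n = 8) — now theorems.  [this work]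
-/

noncomputable section

namespace Summit.CriticalPhenomena.PercolationContinuityZ3.Theorems

namespace TIncFibre

open Finset Literature.Probability.Percolation Literature.Probability.Percolation.DecisionTree
open Literature.Probability.Percolation.Gladkov ThreePointLB TIncSwitching CubicThreePointStep ThreePointGamma
open MeasureTheory Literature.Probability.LatticeModels
open scoped Classical

variable {V : Type} [Fintype V]

omit [Fintype V] in
/-- `R ∅ S u v ↔ ↑S ∈ openConn u v`. [folklore] -/
theorem R_empty_iff_openConn (S : Finset (Sym2 V)) (u v : V) :
    CubicThreePointStep.R ∅ S u v ↔ (↑S : Set (Sym2 V)) ∈ openConn u v := by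
  rw [R_empty_iff]; rfl

section Ident

variable {a y : V} (hay : a ≠ y) (S : Finset (Sym2 V)) (b c : V)
include hay

omit [Fintype V] in
/-- Through the apex edge: `R {ay} S a v ↔ R ∅ S a v ∨ R ∅ S y v`. [folklore] -/
theorem R_apex_iff (v : V) :
    CubicThreePointStep.R (insert s(a, y) ∅) S a v ↔ CubicThreePointStep.R ∅ S a v ∨ CubicThreePointStep.R ∅ S y v := by
  constructor
  · intro h
    rcases reach_insert_cases h with h | ⟨_, h2⟩ | ⟨h1, h2⟩
    · exact Or.inl h
    · exact Or.inr h2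
    · exact Or.inl h2
  · rintro (h | h)
    · exact R_mono_insert _ h
    · exact (R_insert_edge hay).trans (R_mono_insert _ h)

end Ident

/-- **(TB1),(TB2) for every four-point bond-percolation law.**  With `m` the ten masses of `bernsteinCells a b c y` under `prodBernoulli w`:
`0 ≤ threeTB₁ (m 0) … (m 9)` and `0 ≤ threeTB₂ (m 0) … (m 9)` — the `T_inc` twins of `BernsteinPieceB1/B2`, unconditionally. [this work] -/
theorem tincBernsteinPieces (w : Sym2 V → unitInterval) (a b c y : V) :
    0 ≤ threeTB₁ ((prodBernoulli w).real (bernsteinCells a b c y 0)) ((prodBernoulli w).real (bernsteinCells a b c y 1))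
        ((prodBernoulli w).real (bernsteinCells a b c y 2)) ((prodBernoulli w).real (bernsteinCells a b c y 3))
        ((prodBernoulli w).real (bernsteinCells a b c y 4)) ((prodBernoulli w).real (bernsteinCells a b c y 5))
        ((prodBernoulli w).real (bernsteinCells a b c y 6)) ((prodBernoulli w).real (bernsteinCells a b c y 7))
        ((prodBernoulli w).real (bernsteinCells a b c y 8)) ((prodBernoulli w).real (bernsteinCells a b c y 9)) ∧
      0 ≤ threeTB₂ ((prodBernoulli w).real (bernsteinCells a b c y 0)) ((prodBernoulli w).real (bernsteinCells a b c y 1))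
        ((prodBernoulli w).real (bernsteinCells a b c y 2)) ((prodBernoulli w).real (bernsteinCells a b c y 3))
        ((prodBernoulli w).real (bernsteinCells a b c y 4)) ((prodBernoulli w).real (bernsteinCells a b c y 5))
        ((prodBernoulli w).real (bernsteinCells a b c y 6)) ((prodBernoulli w).real (bernsteinCells a b c y 7))
        ((prodBernoulli w).real (bernsteinCells a b c y 8)) ((prodBernoulli w).real (bernsteinCells a b c y 9)) := by
  set p : Sym2 V → ℝ := fun e => (w e : ℝ) with hp
  have hp0 : ∀ e, 0 ≤ p e := fun e => (w e).2.1
  have hp1 : ∀ e, p e ≤ 1 := fun e => (w e).2.2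
  have hco : ∀ (S : Finset (Sym2 V)) (u v : V), CubicThreePointStep.R ∅ S u v ↔ (↑S : Set (Sym2 V)) ∈ openConn u v :=
    fun S u v => R_empty_iff_openConn S u v
  -- the five three-point cells
  have e0 : (prodBernoulli w).real (bernsteinCells a b c y 0) = PrW Finset.univ p (evQ ∅ a b c) :=
    prodBernoulli_real_eq_PrW_univ w fun S => by
      simp only [mem_evQ, hco, bernsteinCells, Set.mem_inter_iff, Set.mem_compl_iff]; tauto
  have e1 : (prodBernoulli w).real (bernsteinCells a b c y 1) = PrW Finset.univ p (evU₁ ∅ a b c) :=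
    prodBernoulli_real_eq_PrW_univ w fun S => by
      simp only [mem_evU₁, hco, bernsteinCells, Set.mem_inter_iff, Set.mem_compl_iff]
  have e2 : (prodBernoulli w).real (bernsteinCells a b c y 2) = PrW Finset.univ p (evU₂ ∅ a b c) :=
    prodBernoulli_real_eq_PrW_univ w fun S => by
      simp only [mem_evU₂, hco, bernsteinCells, Set.mem_inter_iff, Set.mem_compl_iff]
  have e3 : (prodBernoulli w).real (bernsteinCells a b c y 3) = PrW Finset.univ p (evU₃ ∅ a b c) :=
    prodBernoulli_real_eq_PrW_univ w fun S => by
      simp only [mem_evU₃, hco, bernsteinCells, Set.mem_inter_iff, Set.mem_compl_iff]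
  have e4 : (prodBernoulli w).real (bernsteinCells a b c y 4) = PrW Finset.univ p (evT ∅ a b c) :=
    prodBernoulli_real_eq_PrW_univ w fun S => by
      simp only [mem_evT, hco, bernsteinCells, Set.mem_inter_iff]
  by_cases hay : a = y
  · -- degenerate apex pair: every transition cell is empty, both pieces are `3·T_inc`
    subst hay
    have hsym : ∀ u v : V, (openConn u v : Set (BondConfig V)) = openConn v u := fun u v => by
      ext ω; exact ⟨fun h => SimpleGraph.Reachable.symm h, fun h => SimpleGraph.Reachable.symm h⟩
    have z5 : (prodBernoulli w).real (bernsteinCells a b c a 5) = 0 := by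
      rw [measureReal_def, show bernsteinCells a b c a 5 = ∅ from ?_, measure_empty, ENNReal.toReal_zero]
      ext ω; simp only [bernsteinCells, Set.mem_inter_iff, Set.mem_compl_iff, Set.mem_empty_iff_false, iff_false, hsym b a]; tauto
    have z6 : (prodBernoulli w).real (bernsteinCells a b c a 6) = 0 := by
      rw [measureReal_def, show bernsteinCells a b c a 6 = ∅ from ?_, measure_empty, ENNReal.toReal_zero]
      ext ω; simp only [bernsteinCells, Set.mem_inter_iff, Set.mem_compl_iff, Set.mem_empty_iff_false, iff_false, hsym c a]; tauto
    have z7 : (prodBernoulli w).real (bernsteinCells a b c a 7) = 0 := by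
      rw [measureReal_def, show bernsteinCells a b c a 7 = ∅ from ?_, measure_empty, ENNReal.toReal_zero]
      ext ω; simp only [bernsteinCells, Set.mem_inter_iff, Set.mem_compl_iff, Set.mem_empty_iff_false, iff_false, hsym c a]; tauto
    have z8 : (prodBernoulli w).real (bernsteinCells a b c a 8) = 0 := by
      rw [measureReal_def, show bernsteinCells a b c a 8 = ∅ from ?_, measure_empty, ENNReal.toReal_zero]
      ext ω; simp only [bernsteinCells, Set.mem_inter_iff, Set.mem_compl_iff, Set.mem_empty_iff_false, iff_false, hsym b a]; tauto
    have z9 : (prodBernoulli w).real (bernsteinCells a b c a 9) = 0 := by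
      rw [measureReal_def, show bernsteinCells a b c a 9 = ∅ from ?_, measure_empty, ENNReal.toReal_zero]
      ext ω; simp only [bernsteinCells, Set.mem_inter_iff, Set.mem_compl_iff, Set.mem_empty_iff_false, iff_false, hsym b a]; tauto
    rw [z5, z6, z7, z8, z9, e0, e1, e2, e3, e4, threeTB₁_zero, threeTB₂_zero]
    have h := tincW_nonneg hp0 hp1 Finset.univ ∅ a b c
    unfold tincW at h
    constructor <;> linarith
  -- generic apex pair: the step hypothesis at `D = univ`, `K = ∅`, `x = a`, `m = y`
  have hst := stepHypT_holds (V := V) Finset.univ ∅ p hp0 hp1 a b c a y hay (fun S => R_refl ∅ S a)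
  have hap : ∀ (S : Finset (Sym2 V)) (v : V), CubicThreePointStep.R (insert s(a, y) ∅) S a v ↔
      CubicThreePointStep.R ∅ S a v ∨ CubicThreePointStep.R ∅ S y v := fun S v => R_apex_iff hay S v
  have e5 : (prodBernoulli w).real (bernsteinCells a b c y 5) = PrW Finset.univ p (evQ ∅ a b c ∩ evU₁ (insert s(a, y) ∅) a b c) :=
    prodBernoulli_real_eq_PrW_univ w fun S => by
      simp only [Set.mem_inter_iff, mem_evQ, mem_evU₁, hap, bernsteinCells, Set.mem_compl_iff, hco]
      constructor
      · rintro ⟨⟨hab, hac, hbc⟩, hab' | hyb, hnc⟩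
        · exact absurd hab' hab
        · exact ⟨⟨⟨SimpleGraph.Reachable.symm hyb, hab⟩, hac⟩, hbc⟩
      · rintro ⟨⟨⟨hby, hab⟩, hac⟩, hbc⟩
        refine ⟨⟨hab, hac, hbc⟩, Or.inr (SimpleGraph.Reachable.symm hby), ?_⟩
        rintro (h | h)
        · exact hac h
        · have hby' : (openGraph (↑S : Set (Sym2 V))).Reachable b y := hby
          have hyc : (openGraph (↑S : Set (Sym2 V))).Reachable y c := h
          exact hbc (hby'.trans hyc)
  have e6 : (prodBernoulli w).real (bernsteinCells a b c y 6) = PrW Finset.univ p (evQ ∅ a b c ∩ evU₂ (insert s(a, y) ∅) a b c) :=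
    prodBernoulli_real_eq_PrW_univ w fun S => by
      simp only [Set.mem_inter_iff, mem_evQ, mem_evU₂, hap, bernsteinCells, Set.mem_compl_iff, hco]
      constructor
      · rintro ⟨⟨hab, hac, hbc⟩, hac' | hyc, hnb⟩
        · exact absurd hac' hac
        · exact ⟨⟨⟨SimpleGraph.Reachable.symm hyc, hab⟩, hac⟩, hbc⟩
      · rintro ⟨⟨⟨hcy, hab⟩, hac⟩, hbc⟩
        refine ⟨⟨hab, hac, hbc⟩, Or.inr (SimpleGraph.Reachable.symm hcy), ?_⟩
        rintro (h | h)
        · exact hab h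
        · have hyb : (openGraph (↑S : Set (Sym2 V))).Reachable y b := h
          have hcy' : (openGraph (↑S : Set (Sym2 V))).Reachable c y := hcy
          exact hbc (hyb.symm.trans hcy'.symm)
  have e7 : (prodBernoulli w).real (bernsteinCells a b c y 7) = PrW Finset.univ p (evU₁ ∅ a b c ∩ evT (insert s(a, y) ∅) a b c) :=
    prodBernoulli_real_eq_PrW_univ w fun S => by
      simp only [Set.mem_inter_iff, mem_evU₁, mem_evT, hap, bernsteinCells, Set.mem_compl_iff, hco]
      constructor
      · rintro ⟨⟨hab, hac⟩, _, hac' | hyc⟩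
        · exact absurd hac' hac
        · exact ⟨⟨hab, SimpleGraph.Reachable.symm hyc⟩, hac⟩
      · rintro ⟨⟨hab, hcy⟩, hac⟩
        exact ⟨⟨hab, hac⟩, Or.inl hab, Or.inr (SimpleGraph.Reachable.symm hcy)⟩
  have e8 : (prodBernoulli w).real (bernsteinCells a b c y 8) = PrW Finset.univ p (evU₂ ∅ a b c ∩ evT (insert s(a, y) ∅) a b c) :=
    prodBernoulli_real_eq_PrW_univ w fun S => by
      simp only [Set.mem_inter_iff, mem_evU₂, mem_evT, hap, bernsteinCells, Set.mem_compl_iff, hco]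
      constructor
      · rintro ⟨⟨hac, hab⟩, hab' | hyb, _⟩
        · exact absurd hab' hab
        · exact ⟨⟨hac, SimpleGraph.Reachable.symm hyb⟩, hab⟩
      · rintro ⟨⟨hac, hby⟩, hab⟩
        exact ⟨⟨hac, hab⟩, Or.inr (SimpleGraph.Reachable.symm hby), Or.inl hac⟩
  have e9 : (prodBernoulli w).real (bernsteinCells a b c y 9) = PrW Finset.univ p (evU₃ ∅ a b c ∩ evT (insert s(a, y) ∅) a b c) :=
    prodBernoulli_real_eq_PrW_univ w fun S => by
      simp only [Set.mem_inter_iff, mem_evU₃, mem_evT, hap, bernsteinCells, Set.mem_compl_iff, hco]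
      constructor
      · rintro ⟨⟨hbc, hab⟩, hab' | hyb, _⟩
        · exact absurd hab' hab
        · exact ⟨⟨hbc, SimpleGraph.Reachable.symm hyb⟩, hab⟩
      · rintro ⟨⟨hbc, hby⟩, hab⟩
        have hby' : (openGraph (↑S : Set (Sym2 V))).Reachable b y := hby
        have hbc' : (openGraph (↑S : Set (Sym2 V))).Reachable b c := hbc
        exact ⟨⟨hbc, hab⟩, Or.inr hby'.symm, Or.inr (hby'.symm.trans hbc')⟩
  rw [e0, e1, e2, e3, e4, e5, e6, e7, e8, e9]
  exact hst

/-- **(TB1) on every four-point bond-percolation law**, in the statement shape of `BernsteinPieceB1` (with `threeTB₁` for `threeB₁`). [this work] -/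
theorem tincBernsteinPieceB1 : ∀ (V : Type) [Fintype V] (w : Sym2 V → unitInterval) (a b c y : V),
    let m : Fin 10 → ℝ := fun i => (prodBernoulli w).real (bernsteinCells a b c y i)
    0 ≤ threeTB₁ (m 0) (m 1) (m 2) (m 3) (m 4) (m 5) (m 6) (m 7) (m 8) (m 9) :=
  fun _ _ w a b c y => (tincBernsteinPieces w a b c y).1

/-- **(TB2) on every four-point bond-percolation law**, in the statement shape of `BernsteinPieceB2`. [this work] -/
theorem tincBernsteinPieceB2 : ∀ (V : Type) [Fintype V] (w : Sym2 V → unitInterval) (a b c y : V),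
    let m : Fin 10 → ℝ := fun i => (prodBernoulli w).real (bernsteinCells a b c y i)
    0 ≤ threeTB₂ (m 0) (m 1) (m 2) (m 3) (m 4) (m 5) (m 6) (m 7) (m 8) (m 9) :=
  fun _ _ w a b c y => (tincBernsteinPieces w a b c y).2

end TIncFibre

end Summit.CriticalPhenomena.PercolationContinuityZ3.Theorems

end
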